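import Literature.Barriers.AnomalousDissipation.ShearFlowViscositySelectionWild
import Literature.Analysis.FluidPDE.TransportGalerkinExistence
import HarnessLib

/-!
# Barrier (Onsager programme / anomalous dissipation): Cor. 2 of Bardos–Titi–Wiedemann 2012
  from Székelyhidi's theorem alone

Barriers/AnomalousDissipation file completing the reduction of
`BardosTitiWiedemann2012_cor2` (`ShearFlowViscositySelection`): in
`ShearFlowViscositySelectionWild` the corollary was proved from two named facts, Székelyhidi's
wild vortex-sheet solutions (`Szekelyhidi2011_thm11`, convex integration) and the DiPerna–Lions
transport existence fact `Torus.BardosTitiWiedemann2012_transportExistence (Fin 2)`. The second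
is now superseded, for the velocities that actually occur in the printed proof (admissible weak
Euler solutions: bounded, weakly continuous into `L²`, weakly divergence free), by the **proved**
Fourier–Galerkin existence theorem `Torus.transportExistence_of_weaklyContinuous`
(`TransportGalerkin`, `…Scheme`, `…Limit`, `…WeakForm`, `…Existence`). Hence

* `BardosTitiWiedemann2012_cor2_of_szekelyhidi : Szekelyhidi2011_thm11 → BardosTitiWiedemann2012_cor2`,

so that the corollary now rests on the single named fact `Szekelyhidi2011_thm11` (Székelyhidi
2011, Thm. 1.1; its proof is 2-D convex integration, De Lellis–Székelyhidi 2010, Prop. 2).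

## References

* C. Bardos, E. S. Titi, E. Wiedemann, C. R. Math. Acad. Sci. Paris 350 (2012) 757–760, Thm. 1,
  Cor. 2 and its proof (`BardosTitiWiedemann2012`).
* L. Székelyhidi Jr., C. R. Math. Acad. Sci. Paris 349 (2011) 1063–1066, Thm. 1.1
  (`Szekelyhidi2011`).
* R. J. DiPerna, P.-L. Lions, Invent. Math. 98 (1989) 511–547, Prop. II.1 (`DiPernaLions1989Invent`).
-/

open MeasureTheory Set Filter Topology Function
open scoped ENNReal NNReal InnerProductSpace
open Literature.Analysis.FunctionSpaces.Torus (twoHalf planarProj planarProjE planarEmbed planarSect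
  planarShear stLift IsWeaklyDivFree IsWeakNSSolutionWithDataOn IsSmooth)
open Literature.Analysis.FluidPDE.Torus (IsAdmissibleWeakEulerOn IsWeakScalarTransportOn
  isAdmissibleWeakEulerOn_twoHalf transportExistence_of_weaklyContinuous)

noncomputable section

namespace Literature.Barriers.AnomalousDissipation

/-- The flat three-torus `T³ = (ℝ/ℤ)³` (local notation). -/
local notation "𝕋³" => UnitAddTorus (Fin 3)
/-- Euclidean `ℝ³` (local notation). -/
local notation "E³" => EuclideanSpace ℝ (Fin 3)
/-- The flat two-torus `T² = (ℝ/ℤ)²` (local notation). -/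
local notation "𝕋²" => UnitAddTorus (Fin 2)
/-- Euclidean `ℝ²` (local notation). -/
local notation "E²" => EuclideanSpace ℝ (Fin 2)

/-- **Every-time weak incompressibility of admissible weak Euler solutions**: the a.e.-in-time
weak divergence-free condition of the weak formulation upgrades to every `t ∈ [0,T]` by the weak
continuity into `L²` (`∫ ⟪v(t), ∇θ⟫` is continuous on `[0,T]` and vanishes a.e.). [folklore] -/
theorem isWeaklyDivFree_of_isAdmissibleWeakEulerOn {T : ℝ} (hT : 0 < T) {v₀ : 𝕋² → E²} {v : ℝ → 𝕋² → E²}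
    (hadm : IsAdmissibleWeakEulerOn T v₀ v) (t : ℝ) (ht : t ∈ Icc 0 T) : IsWeaklyDivFree (v t) := by
  intro θ hθ
  have hf : ContinuousOn (fun s => ∫ x, ⟪v s x, Literature.Analysis.FunctionSpaces.Torus.gradient θ x⟫_ℝ) (Icc 0 T) :=
    hadm.2.2.1 _ (hθ.gradient.memLp 2)
  have hae : (fun s => ∫ x, ⟪v s x, Literature.Analysis.FunctionSpaces.Torus.gradient θ x⟫_ℝ) =ᵐ[volume.restrict (Icc 0 T)]
      fun _ => (0 : ℝ) := by
    rw [← restrict_Ioo_eq_restrict_Icc]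
    filter_upwards [hadm.1.2.2.1] with s hs
    exact hs θ hθ
  exact Measure.eqOn_Icc_of_ae_eq (μ := volume) hT.ne hae hf continuousOn_const ht

/-- `∫⁻ ‖f‖ₑ² = ofReal (∫ ‖f‖²)` for `f ∈ L²` (a local copy of `Torus.lintegral_enorm_sq_eq_ofReal`
of `NSHopfEnergy`, not imported here to keep the import closure small). [folklore] -/
private theorem lintegral_enorm_sq_eq_ofReal' {E : Type*} [NormedAddCommGroup E] {f : 𝕋² → E}
    (hf : MemLp f 2 volume) : ∫⁻ x, ‖f x‖ₑ ^ 2 = ENNReal.ofReal (∫ x, ‖f x‖ ^ 2) := by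
  rw [ofReal_integral_eq_lintegral_ofReal (hf.integrable_norm_pow two_ne_zero)
    (ae_of_all _ fun x => by positivity)]
  refine lintegral_congr_ae (ae_of_all _ fun x => ?_)
  show ‖f x‖ₑ ^ 2 = ENNReal.ofReal (‖f x‖ ^ 2)
  rw [ENNReal.ofReal_pow (norm_nonneg _), ofReal_norm]

/-- **Transport by an admissible planar weak Euler solution** (the step of the printed proof of
Cor. 2 supplied by DiPerna–Lions theory, here from the proved Galerkin existence theorem): for an
admissible weak Euler solution `v` on `T² × [0,T]`, `T > 0`, bounded on `(0,T) × T²` with `L²`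
slices, and `v₃ ∈ L²(T²)`, there is an admissible weak transport solution `w` of
`∂ₜw + div (v w) = 0`, `w(0) = v₃`. [cite: BardosTitiWiedemann2012, proof of Cor. 2] -/
theorem exists_transport_of_isAdmissibleWeakEulerOn {T : ℝ} (hT : 0 < T) {v₀ : 𝕋² → E²} (hv₀ : MemLp v₀ 2 volume)
    {v : ℝ → 𝕋² → E²} (hadm : IsAdmissibleWeakEulerOn T v₀ v) (hslice : ∀ t ∈ Icc 0 T, MemLp (v t) 2 volume)
    (hbdd : MemLp (stLift v) ∞ (volume.restrict (Ioo 0 T ×ˢ univ))) {v₃ : 𝕋² → ℝ} (hv₃ : MemLp v₃ 2 volume) :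
    ∃ w : ℝ → 𝕋² → ℝ,
      IsWeakScalarTransportOn T 0 v v₃ w ∧ (∀ t ∈ Icc 0 T, MemLp (w t) 2 volume) ∧
      (∀ t ∈ Icc 0 T, ∫⁻ x, ‖w t x‖ₑ ^ 2 ≤ ∫⁻ x, ‖v₃ x‖ₑ ^ 2) ∧
      (∀ g : 𝕋² → ℝ, MemLp g 2 volume → ContinuousOn (fun t => ∫ x, w t x * g x) (Icc 0 T)) ∧
      w 0 = v₃ := by
  have hB : ∀ t ∈ Icc 0 T, ∫ x, ‖v t x‖ ^ 2 ≤ ∫ x, ‖v₀ x‖ ^ 2 := by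
    intro t ht
    have h := hadm.2.2.2 t ht
    rw [lintegral_enorm_sq_eq_ofReal' (hslice t ht), lintegral_enorm_sq_eq_ofReal' hv₀] at h
    exact (ENNReal.ofReal_le_ofReal_iff (integral_nonneg fun x => sq_nonneg _)).1 h
  exact transportExistence_of_weaklyContinuous hT hbdd hslice hB hadm.2.2.1
    (isWeaklyDivFree_of_isAdmissibleWeakEulerOn hT hadm) hv₃

/-- **Cor. 2 of Bardos–Titi–Wiedemann 2012 from Székelyhidi's theorem** (the printed proof of
Cor. 2: Székelyhidi's infinite family of admissible planar solutions with vortex-sheet datum,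
transport of `v₃` by each of them — `exists_transport_of_isAdmissibleWeakEulerOn`, proved — and
the `2½`-dimensional lift `Torus.isAdmissibleWeakEulerOn_twoHalf`, proved). The corollary thus
depends on the single named fact `Szekelyhidi2011_thm11`. [cite: BardosTitiWiedemann2012, Cor. 2] -/
theorem BardosTitiWiedemann2012_cor2_of_szekelyhidi (hS : Szekelyhidi2011_thm11) : BardosTitiWiedemann2012_cor2 := by
  intro v₃ hv₃
  obtain ⟨T, hTpos, S, hSinf, hSpair, hSmem, -, -⟩ := hS
  -- transport `v₃` by each member of the family
  have hW : ∀ v ∈ S, ∃ w : ℝ → 𝕋² → ℝ,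
      IsWeakScalarTransportOn T 0 v v₃ w ∧
      (∀ t ∈ Icc 0 T, MemLp (w t) 2 volume) ∧
      (∀ t ∈ Icc 0 T, ∫⁻ x, ‖w t x‖ₑ ^ 2 ≤ ∫⁻ x, ‖v₃ x‖ₑ ^ 2) ∧
      (∀ g : 𝕋² → ℝ, MemLp g 2 volume → ContinuousOn (fun t => ∫ x, w t x * g x) (Icc 0 T)) ∧
      w 0 = v₃ := by
    intro v hv
    obtain ⟨hadm, hslice, hbdd⟩ := hSmem v hv
    exact exists_transport_of_isAdmissibleWeakEulerOn hTpos memLp_vortexSheetData hadm hslice hbdd hv₃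
  choose! W hW using hW
  -- the lifted family
  set L : (ℝ → 𝕋² → E²) → (ℝ → 𝕋³ → E³) := fun v t => twoHalf (v t) (W v t) with hL_def
  have hLinj : InjOn L S := by
    intro v hv v' hv' hvv'
    funext t y
    have h := congrFun (congrFun hvv' t) (planarSect y)
    have h' := congrArg planarProjE h
    simpa [hL_def, twoHalf, Literature.Analysis.FunctionSpaces.Torus.planarProjE_planarEmbed] using h'
  refine ⟨T, hTpos, L '' S, hSinf.image hLinj, ?_, ?_⟩
  · -- pairwise distinct on some slice
    intro V₃ hV₃ V₃' hV₃' hne hall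
    obtain ⟨v, hv, rfl⟩ := hV₃
    obtain ⟨v', hv', rfl⟩ := hV₃'
    have hvv' : v ≠ v' := fun h => hne (h ▸ rfl)
    exact hSpair hv hv' hvv' fun t ht => ae_eq_of_twoHalf_ae_eq (hall t ht)
  · -- each lift is admissible
    rintro V₃ ⟨v, hv, rfl⟩
    obtain ⟨hadm, hslice, -⟩ := hSmem v hv
    obtain ⟨hwsol, hw2, hwE, hwc, hw0⟩ := hW v hv
    have h := isAdmissibleWeakEulerOn_twoHalf memLp_vortexSheetData hv₃ hadm hslice hwsol hw2 hwE hwc hw0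
    rw [shearData_vortexSheet_eq_twoHalf]
    exact ⟨h.1, h.2.1, h.2.2.1, h.2.2.2⟩

end Literature.Barriers.AnomalousDissipation

end
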